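import Literature.NumberTheory.Automorphic.BrandtModuleHecke
import Literature.NumberTheory.Automorphic.BrandtModuleRamifiedFibre
import Literature.NumberTheory.Automorphic.BrandtMultiplicativityHolds
import HarnessLib

/-!
# Sums over sub-ideals of index `n²`: the Hecke relations for vector-valued functions on lattices
# (Eichler 1973, Ch. II §6 Thm. 2 for the Brandt matrices `B_l(n)` WITH a representation)

Topic `NumberTheory/Automorphic`; theorems only (no definition, no named fact, no instance;
D-0026). Eichler's Brandt matrices of weight `l + 2` (LNM 320, Ch. II §6 (15)) have the entries
`Σ_M R_l(β_M)` over the sub-ideals `M = β_M I_j ⊆ I_i` of index `n²`, `R_l` a representation of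
`Bˣ`; their Hecke relations (ibid. Thm. 2: `B(m) B(n) = B(mn)` for coprime `m, n` (18), and the
prime-power recursion (19)) rest on the same lattice combinatorics as in weight `2` — unique
factorisation of an integral ideal into ideals of coprime norms (ibid. (23)), and the count of the
intermediate ideals at a prime (ibid. (16), `p + 1` or `1`). The tree proved these combinatorics at
the level of LATTICES for the weight-`2` Brandt matrices (`BrandtModuleChains`, `BrandtModuleHecke`,
`BrandtModuleSplitLocal`, `BrandtMultiplicativity(Holds)`: `Subideal O I n`, `Fibre`, `pSub`,
`IsZOrder.IsResiduallySplit.card_fibre`, `exists_unique_intermediate_of_coprime`,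
`IsInvertibleRightIdeal.of_coprime_intermediate`). This file re-reads them for sums
`Σ_{M ∈ Sub(I, n)} Ψ(M)` of an ARBITRARY function `Ψ` on lattices with values in an additive group —
the form needed for the weight-`k` (`Sym^{k-2}`-valued) Brandt operators:

* `finsum_subideal_units_smul` — `Σ_{M ∈ Sub(βI, n)} Ψ(M) = Σ_{M ∈ Sub(I, n)} Ψ(βM)` (`β ∈ Bˣ`).
* `finsum_subideal_one` — `Σ_{M ∈ Sub(I, 1)} Ψ(M) = Ψ(I)`.
* `finsum_subideal_finsum_subideal_eq_finsum_card_fibre_smul` — regrouping chains by their end: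
  `Σ_{J ∈ Sub(I,m)} Σ_{K ∈ Sub(J,n)} Ψ(K) = Σ_{K ∈ Sub(I,mn)} #Fibre(K) • Ψ(K)`.
* `natCard_fibre_eq_one_of_coprime`, `finsum_subideal_finsum_subideal_of_coprime` — for coprime
  `m, n` every fibre is a singleton (Eichler's unique factorisation (23)), so
  **`Σ_{J ∈ Sub(I,m)} Σ_{K ∈ Sub(J,n)} Ψ(K) = Σ_{K ∈ Sub(I,mn)} Ψ(K)`** (Thm. 2 (18)).
* `finsum_subideal_finsum_subideal_prime` — at a residually split prime `p` (division algebra),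
  **`Σ_{J ∈ Sub(I,p^{a+1})} Σ_{K ∈ Sub(J,p)} Ψ(K) = Σ_{K ∈ Sub(I,p^{a+2})} Ψ(K) + p Σ_{K' ∈ Sub(I,p^a)} Ψ(p K')`**
  (Thm. 2 (19) before applying the representation to the central element `p`).

## References

* [Eichler1973] M. Eichler, LNM 320 (1973), Ch. II §6 (15)–(16), Thm. 2 (17)–(19), (23).
* [VignerasLNM800] M.-F. Vignéras, LNM 800 (1980), Ch. III §5 exercice 5.8 (c)–(d).
* [Pizer1980] A. Pizer, J. Algebra 64 (1980), Prop. 2.22.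
-/

noncomputable section

open scoped Pointwise

universe u

namespace Literature.NumberTheory.Automorphic

variable {B : Type u} [Ring B] [Algebra ℚ B] [IsQuaternionAlgebra ℚ B] {O : Submodule ℤ B}
variable {V : Type*} [AddCommGroup V]

/-! ### Translation by units; the trivial index -/

omit [Algebra ℚ B] [IsQuaternionAlgebra ℚ B] in
/-- **Left translation by a unit**: `M ↦ β M` is a bijection `Sub(I, n) → Sub(βI, n)`, so
`Σ_{M ∈ Sub(βI, n)} Ψ(M) = Σ_{M ∈ Sub(I, n)} Ψ(βM)`. [folklore] -/
theorem finsum_subideal_units_smul (β : Bˣ) (I : Submodule ℤ B) (n : ℕ) (Ψ : Submodule ℤ B → V) :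
    ∑ᶠ M : Subideal O (β • I) n, Ψ ((M.1 : invertibleRightIdeals O) : Submodule ℤ B) =
      ∑ᶠ M : Subideal O I n, Ψ (β • ((M.1 : invertibleRightIdeals O) : Submodule ℤ B)) := by
  -- the translation `Sub(I, n) → Sub(βI, n)` and its inverse
  let f : Subideal O I n → Subideal O (β • I) n := fun M =>
    ⟨⟨β • ((M.1 : invertibleRightIdeals O) : Submodule ℤ B), M.1.2.units_smul β⟩,
      units_smul_mono β M.le, by rw [relIndex_units_smul]; exact M.relIndex_eq⟩
  let g : Subideal O (β • I) n → Subideal O I n := fun M' =>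
    ⟨⟨β⁻¹ • ((M'.1 : invertibleRightIdeals O) : Submodule ℤ B), M'.1.2.units_smul β⁻¹⟩,
      by simpa using units_smul_mono β⁻¹ M'.le,
      by simpa using relIndex_units_smul β⁻¹ ((M'.1 : invertibleRightIdeals O) : Submodule ℤ B) (β • I)
        |>.trans M'.relIndex_eq⟩
  have hfg : Function.LeftInverse g f := fun M => Subideal.ext (by
    change β⁻¹ • β • ((M.1 : invertibleRightIdeals O) : Submodule ℤ B) = _
    rw [inv_smul_smul])
  have hgf : Function.RightInverse g f := fun M' => Subideal.ext (by
    change β • β⁻¹ • ((M'.1 : invertibleRightIdeals O) : Submodule ℤ B) = _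
    rw [smul_inv_smul])
  symm
  exact finsum_eq_of_bijective f (Function.bijective_iff_has_inverse.mpr ⟨g, hfg, hgf⟩) fun _ => rfl

omit [Algebra ℚ B] [IsQuaternionAlgebra ℚ B] in
/-- **`Sub(I, 1) = {I}`** for an invertible right ideal `I`: `Σ_{M ∈ Sub(I, 1)} Ψ(M) = Ψ(I)`
(so the Brandt operator `T(1)` is the identity; Eichler 1973 II §6, `B(1) = 1`). [cite: Eichler1973, Ch. II §6 Thm. 2] -/
theorem finsum_subideal_one {I : Submodule ℤ B} (hI : IsInvertibleRightIdeal O I)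
    (Ψ : Submodule ℤ B → V) :
    ∑ᶠ M : Subideal O I 1, Ψ ((M.1 : invertibleRightIdeals O) : Submodule ℤ B) = Ψ I := by
  let M₀ : Subideal O I 1 := ⟨⟨I, hI⟩, le_rfl, (AddSubgroup.relIndex_self _).trans (one_pow 2).symm⟩
  letI : Unique (Subideal O I 1) :=
    { default := M₀
      uniq := fun M => Subideal.ext (le_antisymm M.le (by
        have h : ((M.1 : invertibleRightIdeals O) : Submodule ℤ B).toAddSubgroup.relIndex
            I.toAddSubgroup = 1 := M.relIndex_eq.trans (one_pow 2)
        exact fun x hx => AddSubgroup.relIndex_eq_one.mp h hx)) }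
  rw [finsum_unique]
  rfl

/-! ### Regrouping chains by their end -/

omit [IsQuaternionAlgebra ℚ B] in
/-- **`Σ_{J ∈ Sub(I,m)} Σ_{K ∈ Sub(J,n)} Ψ(K) = Σ_{K ∈ Sub(I,mn)} #Fibre(K) • Ψ(K)`** for a finitely
generated lattice `I` and `m ≠ 0`: regroup the chains `I ⊇ J ⊇ K` by `K` (the pairs
`(J ∈ Sub(I, m), K ∈ Sub(J, n))` correspond to the pairs `(K ∈ Sub(I, mn), J ∈ Fibre(K))`, the
class-free form of `chainEquivSigma`; Eichler 1973 II §6, proof of Thm. 2).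
[cite: Eichler1973, Ch. II §6 Thm. 2 (proof)] -/
theorem finsum_subideal_finsum_subideal_eq_finsum_card_fibre_smul {I : Submodule ℤ B} (hI : I.FG)
    {m : ℕ} (hm : m ≠ 0) (n : ℕ) (Ψ : Submodule ℤ B → V) :
    ∑ᶠ J : Subideal O I m, ∑ᶠ K : Subideal O ((J.1 : invertibleRightIdeals O) : Submodule ℤ B) n,
        Ψ ((K.1 : invertibleRightIdeals O) : Submodule ℤ B) =
      ∑ᶠ K : Subideal O I (m * n),
        Nat.card (Fibre O I m ((K.1 : invertibleRightIdeals O) : Submodule ℤ B)) •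
          Ψ ((K.1 : invertibleRightIdeals O) : Submodule ℤ B) := by
  classical
  haveI : IsAddTorsionFree B := isAddTorsionFree_of_charZero_module ℚ B
  haveI : ∀ k, Finite (Subideal O I k) := fun k => Subideal.finite hI k
  letI : ∀ k, Fintype (Subideal O I k) := fun k => Fintype.ofFinite _
  haveI : ∀ J : Subideal O I m,
      Finite (Subideal O ((J.1 : invertibleRightIdeals O) : Submodule ℤ B) n) :=
    fun J => Subideal.finite J.isInvertibleRightIdeal.isFullLattice.1 n
  letI : ∀ J : Subideal O I m,
      Fintype (Subideal O ((J.1 : invertibleRightIdeals O) : Submodule ℤ B) n) :=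
    fun J => Fintype.ofFinite _
  letI : ∀ K : Subideal O I (m * n),
      Fintype (Fibre O I m ((K.1 : invertibleRightIdeals O) : Submodule ℤ B)) :=
    fun K => Fintype.ofFinite _
  -- regrouping equivalence
  let e : (Σ J : Subideal O I m, Subideal O ((J.1 : invertibleRightIdeals O) : Submodule ℤ B) n) ≃
      Σ K : Subideal O I (m * n), Fibre O I m ((K.1 : invertibleRightIdeals O) : Submodule ℤ B) :=
    { toFun := fun x => ⟨⟨x.2.1, x.2.le.trans x.1.le,
          relIndex_chain x.2.le x.1.le x.1.relIndex_eq x.2.relIndex_eq⟩, ⟨x.1, x.2.le⟩⟩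
      invFun := fun y => ⟨y.2.1, ⟨y.1.1, y.2.2,
          relIndex_of_chain hm y.2.2 y.2.1.le y.2.1.relIndex_eq y.1.relIndex_eq⟩⟩
      left_inv := fun _ => rfl
      right_inv := fun _ => rfl }
  -- both sides as sums over the sigma types
  have hL : (∑ᶠ J : Subideal O I m, ∑ᶠ K : Subideal O ((J.1 : invertibleRightIdeals O) : Submodule ℤ B) n,
      Ψ ((K.1 : invertibleRightIdeals O) : Submodule ℤ B)) =
      ∑ x : (Σ J : Subideal O I m, Subideal O ((J.1 : invertibleRightIdeals O) : Submodule ℤ B) n),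
        Ψ ((x.2.1 : invertibleRightIdeals O) : Submodule ℤ B) := by
    rw [finsum_eq_sum_of_fintype]
    have h1 : ∀ J : Subideal O I m,
        (∑ᶠ K : Subideal O ((J.1 : invertibleRightIdeals O) : Submodule ℤ B) n,
          Ψ ((K.1 : invertibleRightIdeals O) : Submodule ℤ B)) =
        ∑ K : Subideal O ((J.1 : invertibleRightIdeals O) : Submodule ℤ B) n,
          Ψ ((K.1 : invertibleRightIdeals O) : Submodule ℤ B) := fun J =>
      finsum_eq_sum_of_fintype (fun K : Subideal O ((J.1 : invertibleRightIdeals O) : Submodule ℤ B) n =>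
        Ψ ((K.1 : invertibleRightIdeals O) : Submodule ℤ B))
    have h2 := Fintype.sum_sigma
      (fun x : (Σ J : Subideal O I m, Subideal O ((J.1 : invertibleRightIdeals O) : Submodule ℤ B) n) =>
        Ψ ((x.2.1 : invertibleRightIdeals O) : Submodule ℤ B))
    dsimp only at h2
    rw [h2]
    exact Finset.sum_congr rfl fun J _ => h1 J
  have hR : (∑ᶠ K : Subideal O I (m * n),
      Nat.card (Fibre O I m ((K.1 : invertibleRightIdeals O) : Submodule ℤ B)) •
        Ψ ((K.1 : invertibleRightIdeals O) : Submodule ℤ B)) =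
      ∑ y : (Σ K : Subideal O I (m * n), Fibre O I m ((K.1 : invertibleRightIdeals O) : Submodule ℤ B)),
        Ψ ((y.1.1 : invertibleRightIdeals O) : Submodule ℤ B) := by
    rw [finsum_eq_sum_of_fintype]
    have h2 := Fintype.sum_sigma
      (fun y : (Σ K : Subideal O I (m * n), Fibre O I m ((K.1 : invertibleRightIdeals O) : Submodule ℤ B)) =>
        Ψ ((y.1.1 : invertibleRightIdeals O) : Submodule ℤ B))
    dsimp only at h2
    rw [h2]
    refine Finset.sum_congr rfl fun K _ => ?_
    rw [Finset.sum_const, Finset.card_univ, ← Nat.card_eq_fintype_card]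
  rw [hL, hR]
  exact Fintype.sum_equiv e _ _ fun _ => rfl

/-! ### Coprime indices: unique factorisation -/

omit [Algebra ℚ B] [IsQuaternionAlgebra ℚ B] in
/-- **Unique factorisation** (Eichler 1973 II §6 (23)): for coprime `m, n ≠ 0` and invertible
`K ⊆ I` of index `(mn)²` there is exactly one invertible `J` with `K ⊆ J ⊆ I`, `[I : J] = m²` —
the fibre of `K` is a singleton (`exists_unique_intermediate_of_coprime`,
`IsInvertibleRightIdeal.of_coprime_intermediate`). [cite: Eichler1973, Ch. II §6 Thm. 2, (23)] -/
theorem natCard_fibre_eq_one_of_coprime {I : Submodule ℤ B} (hI : IsInvertibleRightIdeal O I)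
    {m n : ℕ} (hm : m ≠ 0) (hn : n ≠ 0) (hmn : m.Coprime n) (K : Subideal O I (m * n)) :
    Nat.card (Fibre O I m ((K.1 : invertibleRightIdeals O) : Submodule ℤ B)) = 1 := by
  have hab : (n ^ 2).Coprime (m ^ 2) := Nat.Coprime.pow 2 2 hmn.symm
  have hab0 : n ^ 2 * m ^ 2 ≠ 0 := mul_ne_zero (pow_ne_zero 2 hn) (pow_ne_zero 2 hm)
  have hidx : ((K.1 : invertibleRightIdeals O) : Submodule ℤ B).toAddSubgroup.relIndex
      I.toAddSubgroup = n ^ 2 * m ^ 2 := K.relIndex_eq.trans (by ring)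
  obtain ⟨J₀, hKJ₀, hJ₀I, hKJ₀idx, hJ₀Iidx, huniq⟩ :=
    exists_unique_intermediate_of_coprime K.le hab hab0 hidx
  have hJ₀ : IsInvertibleRightIdeal O J₀ :=
    IsInvertibleRightIdeal.of_coprime_intermediate K.isInvertibleRightIdeal hI hKJ₀ hJ₀I
      (by rw [hKJ₀idx, hJ₀Iidx]; exact hab)
  let F₀ : Fibre O I m ((K.1 : invertibleRightIdeals O) : Submodule ℤ B) :=
    ⟨⟨⟨J₀, hJ₀⟩, hJ₀I, hJ₀Iidx⟩, hKJ₀⟩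
  letI : Unique (Fibre O I m ((K.1 : invertibleRightIdeals O) : Submodule ℤ B)) :=
    { default := F₀
      uniq := fun F => by
        apply Subtype.ext; apply Subideal.ext
        exact huniq _ F.2 F.1.le (relIndex_of_chain hm F.2 F.1.le F.1.relIndex_eq K.relIndex_eq) }
  exact Nat.card_unique

omit [IsQuaternionAlgebra ℚ B] in
/-- **`Σ_{J ∈ Sub(I,m)} Σ_{K ∈ Sub(J,n)} Ψ(K) = Σ_{K ∈ Sub(I,mn)} Ψ(K)` for coprime `m, n`** and an
invertible right ideal `I` — the lattice form of `B(m) B(n) = B(mn)` (Eichler 1973 II §6 Thm. 2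
(18); Vignéras III §5 ex. 5.8 (c)). [cite: Eichler1973, Ch. II §6 Thm. 2 (18)] -/
theorem finsum_subideal_finsum_subideal_of_coprime {I : Submodule ℤ B} (hI : IsInvertibleRightIdeal O I)
    {m n : ℕ} (hm : m ≠ 0) (hn : n ≠ 0) (hmn : m.Coprime n) (Ψ : Submodule ℤ B → V) :
    ∑ᶠ J : Subideal O I m, ∑ᶠ K : Subideal O ((J.1 : invertibleRightIdeals O) : Submodule ℤ B) n,
        Ψ ((K.1 : invertibleRightIdeals O) : Submodule ℤ B) =
      ∑ᶠ K : Subideal O I (m * n), Ψ ((K.1 : invertibleRightIdeals O) : Submodule ℤ B) := by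
  rw [finsum_subideal_finsum_subideal_eq_finsum_card_fibre_smul hI.isFullLattice.1 hm n Ψ]
  refine finsum_congr fun K => ?_
  rw [natCard_fibre_eq_one_of_coprime hI hm hn hmn K, one_smul]

/-! ### One prime: the recursion from the fibre count -/

/-- **`Σ_{J ∈ Sub(I,p^{a+1})} Σ_{K ∈ Sub(J,p)} Ψ(K) = Σ_{K ∈ Sub(I,p^{a+2})} Ψ(K) + p Σ_{K' ∈ Sub(I,p^a)} Ψ(p K')`**
at a residually split prime `p` of a `ℤ`-order `O` in a division quaternion algebra over `ℚ`, for an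
invertible right ideal `I` (the fibre over `K` has `p + 1` elements if `K ⊆ p I` — and then `K = p K'`
— and `1` otherwise: `IsZOrder.IsResiduallySplit.card_fibre`, `pSub` / `pSubInv`). This is the
lattice form of Eichler's recursion `B(p^{a+1}) B(p) = B(p^{a+2}) + p B(p^a) R(p)` (LNM 320 II §6
Thm. 2 (19)). [cite: Eichler1973, Ch. II §6 Thm. 2 (19)] [cite: VignerasLNM800, Ch. III §5 exercice 5.8 (c)] -/
theorem finsum_subideal_finsum_subideal_prime (hdiv : ∀ x : B, x ≠ 0 → IsUnit x) (hO : IsZOrder O)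
    {p : ℕ} (hp : p.Prime) (hsplit : hO.IsResiduallySplit p) {I : Submodule ℤ B}
    (hI : IsInvertibleRightIdeal O I) (a : ℕ) {u : Bˣ} (hu : (u : B) = p) (Ψ : Submodule ℤ B → V) :
    ∑ᶠ J : Subideal O I (p ^ (a + 1)), ∑ᶠ K : Subideal O ((J.1 : invertibleRightIdeals O) : Submodule ℤ B) p,
        Ψ ((K.1 : invertibleRightIdeals O) : Submodule ℤ B) =
      ∑ᶠ K : Subideal O I (p ^ (a + 1) * p), Ψ ((K.1 : invertibleRightIdeals O) : Submodule ℤ B) +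
        p • ∑ᶠ K' : Subideal O I (p ^ a), Ψ (u • ((K'.1 : invertibleRightIdeals O) : Submodule ℤ B)) := by
  classical
  haveI : IsAddTorsionFree B := isAddTorsionFree_of_charZero_module ℚ B
  have hIfg : I.FG := hI.isFullLattice.1
  haveI : ∀ k, Finite (Subideal O I k) := fun k => Subideal.finite hIfg k
  letI : ∀ k, Fintype (Subideal O I k) := fun k => Fintype.ofFinite _
  rw [finsum_subideal_finsum_subideal_eq_finsum_card_fibre_smul hIfg (pow_ne_zero _ hp.ne_zero) p Ψ,
    finsum_eq_sum_of_fintype, finsum_eq_sum_of_fintype, finsum_eq_sum_of_fintype]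
  -- the predicate `K ⊆ p I` and the fibre count
  let P : Subideal O I (p ^ (a + 1) * p) → Prop :=
    fun K => ((K.1 : invertibleRightIdeals O) : Submodule ℤ B) ≤ (p : ℤ) • I
  have hcard : ∀ K : Subideal O I (p ^ (a + 1) * p),
      Nat.card (Fibre O I (p ^ (a + 1)) ((K.1 : invertibleRightIdeals O) : Submodule ℤ B)) •
          Ψ ((K.1 : invertibleRightIdeals O) : Submodule ℤ B) =
        Ψ ((K.1 : invertibleRightIdeals O) : Submodule ℤ B) +
          (if P K then p • Ψ ((K.1 : invertibleRightIdeals O) : Submodule ℤ B) else 0) := by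
    intro K
    by_cases hK : P K
    · rw [(hsplit.card_fibre hdiv hp hI K).1 hK, if_pos hK, add_smul, one_smul, add_comm]
    · rw [(hsplit.card_fibre hdiv hp hI K).2 hK, if_neg hK, one_smul, add_zero]
  rw [Finset.sum_congr rfl fun K _ => hcard K, Finset.sum_add_distrib, ← Finset.sum_filter,
    ← Finset.smul_sum]
  congr 2
  -- `K ⊆ p I ↔ K = p K'`: reindex the filtered sum by `Sub(I, p^a)`
  rw [Finset.sum_subtype (Finset.univ.filter P) (p := P)
    (fun K => by rw [Finset.mem_filter, and_iff_right (Finset.mem_univ K)])]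
  let e : Subideal O I (p ^ a) ≃ {K // P K} :=
    { toFun := fun K' => ⟨pSub O I hu K', by
        change (((pSub O I hu K').1 : invertibleRightIdeals O) : Submodule ℤ B) ≤ (p : ℤ) • I
        rw [coe_pSub, units_smul_eq_natCast_smul hu]; exact zsmul_mono _ K'.le⟩
      invFun := fun K => pSubInv O I hp hu K.1 K.2
      left_inv := fun K' => by
        apply Subideal.ext
        rw [coe_pSubInv, coe_pSub, inv_smul_smul]
      right_inv := fun K => by
        apply Subtype.ext; apply Subideal.ext
        rw [coe_pSub, coe_pSubInv, smul_inv_smul] }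
  symm
  exact Fintype.sum_equiv e _ (fun K => Ψ ((K.1.1 : invertibleRightIdeals O) : Submodule ℤ B))
    fun K' => rfl

end Literature.NumberTheory.Automorphic

end
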